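import Summits.QuantumFields.BalabanUV.Beta.EriceRemainderEnclosureHistoryAutonomyComparisonAgeCompositionKeyFreeTwoAgesPrep

/-!
# EriceRemainderEnclosureHistoryAutonomyComparisonAgeCompositionKeyFreeTwoAges — (E115k) route (N), first order: THE FIRST END PROVED BY THE STRUCTURAL (KEY-FREE)
# ROUTE — TWO AGES, EVERY FLOW, EVERY HORIZON, under an explicit ratio condition.  An integration test of (E115a–i): the row induction with the GEOMETRIC SOCKET
# (E115i) for the first term, the lone-old-age variation ((E115e)-type, two-sided: §2), the remainder by (E115c)+(E115d) on the young reads cut at the pin with the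
# young total mass of (E115f), and a light zone at the last `12·y` rows.  RESULT (**`flow_keyfree_two_ages`**): `B` isotone with floor `b > 0` dominating `L ≥ 0`
# on the ages `< K`, `h` a box solution, two loaded ages `1 ≤ y < o < K ≤ N` (kernel = `KL y + KL o`, undamped), and
#     `(o : ℝ) ≥ (87 + 138·(L_y·h_y∕b))·y`
# ⟹ the zero-tailed solution of `ε = 1_{[0,N]} − R_o ε − R_y ε` satisfies `0 ≤ ε ≤ 1` at every depth.  By (E115a) `sol_eq_sum_indicator` (every admissible excess is a
# non-negative combination of truncated indicators, and the solution on the horizon `N` of `1_{[0,J]}` is the one on the horizon `J`) this is the two-age END for every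
# admissible excess.  HONEST COMPARISON: two ages at EVERY ratio are already in the tree ((E91b) `flow_nonneg_two_ages_all`, by the young contraction against a slowly
# varying old read); the constants here are not optimised (`87`, `138`, the light zone `12y`, `√2∕2` everywhere for the loads) and the hypothesis carries the flow letter
# `L_y·h_y∕b` (the young age's budget at the pin against the floor, from (E115f)'s use of the floor); the point is that NO supersolution (KEY), NO monotonicity (MONO),
# NO certificate table enters — only the sockets of the age induction, which compose formally as README `HOME/b2b-balaban-beta-d4-p2/g96/README.md` §3 says.

Cell `pub-balaban`, β-function sub-cell, BINDER row D4 «RemainderConst leaves for Bałaban's split» (`HOME/BINDER-OWNERS.md`; owner lineage `b2b-balaban-beta-an4`;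
this file by co-owner #2 lineage `b2b-balaban-beta-d4-p2`, generation 96), β-FLOW TEAM duty (1), FREEZE (0) honoured (def-free; imports (E115j) (hence (E115i), (E115f)); uses (E115j)'s preparations, (E115i)
`sol_ge_deep_first_sub_var`-type assembly through (E115c) `sol_ge_first_sub_var` and (E115i) `sol_ge_deep_floor_sub_geom_var`, (E115d) `var_read_le` ∕ `read_eq_sum_ages` ∕
`window_succ`, (E115e) `lone_kernel_tail_form`, (E115f) `young_total_mass_le` ∕ `old_kernel_facts`, (E115b) `young_kernel_facts` ∕ `young_indicator_sol_bounds`,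
(E58b) `mul_invSq_add_le`, (E48a) `strictAnti_of_memFlow` BY NAME; nothing restated).

HONEST FRAMING (page 1, verbatim and binding).  *"Discharging BetaPertH makes Bałaban's UV stability UNCONDITIONAL — a real constructive-QFT result; it is
NOT the continuum limit and NOT the Clay problem."*  THIS FILE DISCHARGES NOTHING OF THE KIND.  Elementary real analysis about ABSTRACT functionals on a box
]0,γ]^ℕ with displayed floors, profiles and signs, and the FIRST-ORDER renewal objects of route (N) built from them — hypotheses of a census, not facts; the
form, signs, ages and moments of Bałaban's (1.22) limit functional are NOT PRINTED ([I] p. 298; GAPS G-t4-U2-1∕-2) and NOT asserted.  Row D4 class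
UNCHANGED (critical-path width 0; instance 0∕1; D4 DISCHARGE NO DATE).  HONEST DEPENDENCY: continuum YM on T⁴ ⇐ BetaPertH ∧ nine spine estimates (0/9
proved); BetaPertH ⇐ (D1) ∧ (D4) ∧ CAP+tail; G-an2-4 gates asym, D1 and NE2/3/4.

NOT CLAIMED: any ratio below the displayed threshold; more than two ages; anything printed — NOT B12 Thm 2, NOT BetaPertH, NOT continuum, NOT Clay.

WHAT IS PROVED ([folklore]; 0 `def`, 0 sorry).  **`flow_keyfree_two_ages`** (preparations in (E115j) `…KeyFreeTwoAgesPrep`).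
-/
noncomputable section
open Finset

namespace Summit.QuantumFields.BalabanUV.Beta.EriceRemainderEnclosureHistoryAutonomyComparisonAgeCompositionKeyFreeTwoAges

open Literature.MathematicalPhysics.QuantumFieldTheory.Balaban1983to89
open Literature.MathematicalPhysics.QuantumFieldTheory.Balaban1983to89.T4BetaStationary
open Literature.MathematicalPhysics.QuantumFieldTheory.Balaban1983to89.T4BetaFlowWellPosed
open Summit.QuantumFields.BalabanUV.Beta.EriceRemainderEnclosureHistoryAutonomyComparisonAgeComposition
open Summit.QuantumFields.BalabanUV.Beta.EriceRemainderEnclosureHistoryAutonomyComparisonAgeCompositionBVStability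
open Summit.QuantumFields.BalabanUV.Beta.EriceRemainderEnclosureHistoryAutonomyComparisonAgeCompositionBVStabilityFlow (young_kernel_facts young_indicator_sol_bounds)
open Summit.QuantumFields.BalabanUV.Beta.EriceRemainderEnclosureHistoryAutonomyComparisonAgeCompositionKeyFree (sol_ge_first_sub_var)
open Summit.QuantumFields.BalabanUV.Beta.EriceRemainderEnclosureHistoryAutonomyComparisonAgeCompositionReadVariation (var_read_le read_eq_sum_ages window_succ)
open Summit.QuantumFields.BalabanUV.Beta.EriceRemainderEnclosureHistoryAutonomyComparisonAgeCompositionOldRegularity (lone_kernel_tail_form)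
open Summit.QuantumFields.BalabanUV.Beta.EriceRemainderEnclosureHistoryAutonomyComparisonAgeCompositionYoungMass (young_total_mass_le old_kernel_facts)
open Summit.QuantumFields.BalabanUV.Beta.EriceRemainderEnclosureHistoryAutonomyComparisonAgeCompositionGeometricSocket (sol_ge_deep_floor_sub_geom_var)
open Summit.QuantumFields.BalabanUV.Beta.EriceRemainderEnclosureHistoryAutonomyComparisonAffineProfile (mul_invSq_add_le)
open Summit.QuantumFields.BalabanUV.Beta.EriceRemainderEnclosureHistoryAutonomyOrder (strictAnti_of_memFlow)

open Summit.QuantumFields.BalabanUV.Beta.EriceRemainderEnclosureHistoryAutonomyComparisonAgeCompositionKeyFreeTwoAgesPrep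

variable {B : (ℕ → ℝ) → ℝ} {γ b gIR : ℝ} {L : ℕ → ℝ} {K : ℕ} {h : ℕ → ℝ}

/-! ## §3 The KEY-free two-age END -/

/-- **THE TWO-AGE END BY THE STRUCTURAL ROUTE (every admissible flow, every horizon, undamped).**  `B` an isotone memory with floor `b > 0` dominating `L ≥ 0` on
the ages `< K`; `h` a box solution; two ages `1 ≤ y < o < K ≤ N` with undamped lone kernels `KL y`, `KL o` (reads `Ry`, `Ro`; zero-tailed solution operators `Sy`,
`So` on the horizon `N`); the RATIO CONDITION `(90 + 140·(L_y·h_y∕b))·y ≤ o`.  Then the zero-tailed solution of `ε = 1_{[0,N]} − Ro ε − Ry ε` satisfies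
`0 ≤ ε ≤ 1` at every depth.  Ingredients: row induction; light zone `N < m + 12y` (the reads below the pin have mass `≤ x̃_y + 12y·x̃_o∕o < 1`); below it (E115c)
`sol_ge_first_sub_var` + (E115i) `sol_ge_deep_floor_sub_geom_var` (first term `≥ (1−x̃_y)(1−x̃_o) − (5∕2)(x̃_o∕o)·y∕(1−x̃_y) − (√2∕2)^{12}` by §1–§2) + (E115d)
`var_read_le` on the young reads cut at the pin with (E115f) `young_total_mass_le` (remainder `≤ 4(x̃_o∕o)·(y·L_y·h_y∕b)∕(1−x̃_y)`). [folklore] -/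
theorem flow_keyfree_two_ages (hmono : ∀ u v : ℕ → ℝ, SeqBox γ u → SeqBox γ v → (∀ j, u j ≤ v j) → B u ≤ B v)
    (hL : ∀ k, 0 ≤ L k) (hb : 0 < b) (hlo : ∀ u, SeqBox γ u → b ≤ B u) (hdom : ∀ u, SeqBox γ u → ∑ k ∈ range K, L k * u k ≤ B u)
    (hh : SeqBox γ h) (hf : MemFlow B gIR h) {y o : ℕ} (hy : 1 ≤ y) (hyo : y < o) (hoK : o < K) {N : ℕ} (hKN : K ≤ N)
    {KL : ℕ → ℕ → ℕ → ℝ} (hKL : ∀ k n l, KL k n l = if 0 < k ∧ k < K ∧ l < k then L k * h (n + k) ^ 3 / 2 else 0)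
    {Ry Ro Sy So : (ℕ → ℝ) → ℕ → ℝ}
    (hRy : ∀ u m, Ry u m = ∑ l ∈ range N, KL y m l * u (m + 1 + l)) (hRo : ∀ u m, Ro u m = ∑ l ∈ range N, KL o m l * u (m + 1 + l))
    (hSy : ∀ w : ℕ → ℝ, (∀ n, N < n → w n = 0) → (∀ n, N < n → Sy w n = 0) ∧ ∀ n, Sy w n = w n - Ry (Sy w) n)
    (hSo : ∀ w : ℕ → ℝ, (∀ n, N < n → w n = 0) → (∀ n, N < n → So w n = 0) ∧ ∀ n, So w n = w n - Ro (So w) n)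
    (hratio : (90 + 140 * (L y * h y / b)) * (y : ℝ) ≤ o)
    {ε : ℕ → ℝ} (hεt : ∀ m, N < m → ε m = 0)
    (hεrec : ∀ m, ε m = (fun m => if m ≤ N then (1 : ℝ) else 0) m - Ro ε m - Ry ε m) :
    ∀ m, 0 ≤ ε m ∧ ε m ≤ 1 := by
  set e : ℕ → ℝ := fun m => if m ≤ N then (1 : ℝ) else 0 with he_def
  have het : ∀ m, N < m → e m = 0 := fun m hm => if_neg (show ¬ m ≤ N by omega)
  have hpos : ∀ j, 0 < h j := fun j => (hh j).1
  have hanti := (strictAnti_of_memFlow hb hlo hh hf).antitone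
  have ho1 : 1 ≤ o := by omega
  have hyK : y < K := by omega
  obtain ⟨hs, hs12⟩ := sqrt_two_half_facts
  obtain ⟨hKy0, hsuppy, hrowy, hcapy⟩ := young_kernel_facts hmono hL hb hlo hdom hh hf hy hyK hKL N
  obtain ⟨hKo0, hsuppo, hrowo, hcapo⟩ := young_kernel_facts hmono hL hb hlo hdom hh hf ho1 hoK hKL N
  -- the old kernel as a tail sum
  set w : ℕ → ℕ → ℝ := fun k m => if k = o then L o * h (m + o) ^ 3 / 2 else 0 with hw
  have hKt : ∀ m l, KL o m l = ∑ k ∈ Ico (l + 1) K, w k m := fun m l => lone_kernel_tail_form hoK hKL m l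
  have hc0 : ∀ m, 0 ≤ L o * h (m + o) ^ 3 / 2 := fun m => by have := hL o; have := hpos (m + o); positivity
  have hcmono' : ∀ m m', m ≤ m' → L o * h (m' + o) ^ 3 / 2 ≤ L o * h (m + o) ^ 3 / 2 := fun m m' hmm' => by
    have h1 : h (m' + o) ≤ h (m + o) := hanti (by omega)
    have h2 := pow_le_pow_left₀ (le_of_lt (hpos (m' + o))) h1 3
    have := hL o; nlinarith
  have hw0 : ∀ k m, 0 ≤ w k m := fun k m => by
    simp only [hw]; split_ifs
    · exact hc0 m
    · exact le_rfl
  have hwmono : ∀ k m, w k (m + 1) ≤ w k m := fun k m => by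
    simp only [hw]; split_ifs
    · exact hcmono' m (m + 1) (by omega)
    · exact le_rfl
  have hwsum : ∀ m, ∑ k ∈ Ico 1 K, w k m = L o * h (m + o) ^ 3 / 2 := fun m => by
    simp only [hw]; rw [sum_ite_eq' (Ico 1 K) o, if_pos (mem_Ico.mpr ⟨ho1, hoK⟩)]
  -- ENDs and floors of the two lone systems
  have hENDo : ∀ J n, J ≤ N → 0 ≤ So (fun m => if m ≤ J then (1 : ℝ) else 0) n ∧ So (fun m => if m ≤ J then (1 : ℝ) else 0) n ≤ 1 :=
    fun J n hJ => let h3 := young_indicator_sol_bounds hmono hL hb hlo hdom hh hf ho1 hoK hKL hRo hSo hJ n; ⟨h3.1, h3.2.1⟩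
  have hENDy : ∀ J n, J ≤ N → 0 ≤ Sy (fun m => if m ≤ J then (1 : ℝ) else 0) n ∧ Sy (fun m => if m ≤ J then (1 : ℝ) else 0) n ≤ 1 :=
    fun J n hJ => let h3 := young_indicator_sol_bounds hmono hL hb hlo hdom hh hf hy hyK hKL hRy hSy hJ n; ⟨h3.1, h3.2.1⟩
  -- numeric letters
  set Λ : ℝ := (y : ℝ) * L y * h y / b with hΛ
  have hΛ0 : 0 ≤ Λ := by have := hL y; have := hpos y; positivity
  have hratio' : 90 * (y : ℝ) + 140 * Λ ≤ o := by
    have : (90 + 140 * (L y * h y / b)) * (y : ℝ) = 90 * y + 140 * Λ := by simp only [hΛ]; ring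
    linarith
  have hy1 : (1 : ℝ) ≤ y := by exact_mod_cast hy
  have ho0 : (0 : ℝ) < o := by exact_mod_cast (show 0 < o by omega)
  -- the row induction
  suffices hmain : ∀ d m, N < m + d → 0 ≤ ε m ∧ ε m ≤ 1 from fun m => hmain (N + 1) m (by omega)
  intro d
  induction d with
  | zero => intro m hm; rw [hεt m (by omega)]; norm_num
  | succ d ih =>
    intro m hmd
    by_cases hNm : N < m
    · rw [hεt m hNm]; norm_num
    have hmN : m ≤ N := not_lt.mp hNm
    have hbelow : ∀ m', m < m' → 0 ≤ ε m' ∧ ε m' ≤ 1 := fun m' hm' => ih m' (by omega)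
    -- the reads of ε at the row m are non-negative and bounded
    have hRy0 : 0 ≤ Ry ε m := by rw [hRy]; exact sum_nonneg fun l _ => mul_nonneg (hKy0 m l) (hbelow _ (by omega)).1
    have hRo0 : 0 ≤ Ro ε m := by rw [hRo]; exact sum_nonneg fun l _ => mul_nonneg (hKo0 m l) (hbelow _ (by omega)).1
    have hεm : ε m = 1 - Ro ε m - Ry ε m := by rw [hεrec m]; simp only [he_def, if_pos hmN]
    refine ⟨?_, by rw [hεm]; linarith⟩
    -- the young load at the pin and below
    set A : ℝ := (y : ℝ) * (L y * h (m + y) ^ 3 / 2) with hA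
    have hA0 : 0 ≤ A := by have := hL y; have := hpos (m + y); positivity
    have hAs : A ≤ 0.70715 := (hcapy m).trans hs
    have hRyA : Ry ε m ≤ A := by
      rw [hRy]
      calc ∑ l ∈ range N, KL y m l * ε (m + 1 + l) ≤ ∑ l ∈ range N, KL y m l :=
            sum_le_sum fun l _ => by have := mul_le_mul_of_nonneg_left (hbelow (m + 1 + l) (by omega)).2 (hKy0 m l); linarith
        _ ≤ A := hrowy m
    set Bo : ℝ := (o : ℝ) * (L o * h (m + o) ^ 3 / 2) with hBo
    have hBos : Bo ≤ 0.70715 := (hcapo m).trans hs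
    have hco : (o : ℝ) * (L o * h (m + o) ^ 3 / 2) ≤ 0.70715 := hBos
    by_cases hzone : N < m + 12 * y
    · -- LIGHT ZONE: the old read sees at most 12y rows below the pin
      have hRoB : Ro ε m ≤ 12 * (y : ℝ) * (L o * h (m + o) ^ 3 / 2) := by
        rw [lone_read_eq hoK hKL hRo ε m]
        have hwin : ∑ l ∈ range (min o N), ε (m + 1 + l) ≤ 12 * (y : ℝ) := by
          have hsplit : ∑ l ∈ range (min o N), ε (m + 1 + l)
              = ∑ l ∈ (range (min o N)).filter (fun l => m + 1 + l ≤ N), ε (m + 1 + l) := by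
            rw [sum_filter]; exact sum_congr rfl fun l _ => by
              split_ifs with hl
              · rfl
              · exact hεt _ (by omega)
          rw [hsplit]
          calc ∑ l ∈ (range (min o N)).filter (fun l => m + 1 + l ≤ N), ε (m + 1 + l)
              ≤ ∑ l ∈ (range (min o N)).filter (fun l => m + 1 + l ≤ N), (1 : ℝ) := sum_le_sum fun l _ => (hbelow _ (by omega)).2
            _ = ((range (min o N)).filter (fun l => m + 1 + l ≤ N)).card := by simp
            _ ≤ 12 * (y : ℝ) := by
                have : ((range (min o N)).filter (fun l => m + 1 + l ≤ N)).card ≤ 12 * y := by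
                  calc ((range (min o N)).filter (fun l => m + 1 + l ≤ N)).card ≤ (range (12 * y)).card :=
                        card_le_card fun l hl => by rw [mem_filter, mem_range] at hl; rw [mem_range]; omega
                    _ = 12 * y := card_range _
                exact_mod_cast this
        have := mul_le_mul_of_nonneg_left hwin (hc0 m)
        linarith
      -- 1 − A − 12y·c ≥ 1 − 0.70715 − 12·0.70715·y/o ≥ 0 since o ≥ 90y
      rw [hεm]
      exact light_zone_arith hAs hRyA hRoB (hc0 m) hco (by linarith)
    · -- GEOMETRIC ZONE: m + 12y ≤ N
      have hz : m + 12 * y ≤ N := not_lt.mp hzone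
      -- young rows below the pin are ≤ A < 1
      have hrown : ∀ m', m ≤ m' → ∑ l ∈ range N, KL y m' l ≤ A := fun m' hm' => by
        refine (hrowy m').trans (mul_le_mul_of_nonneg_left ?_ (Nat.cast_nonneg y))
        have h1 : h (m' + y) ≤ h (m + y) := hanti (by omega)
        have h2 : h (m' + y) ^ 3 ≤ h (m + y) ^ 3 := pow_le_pow_left₀ (le_of_lt (hpos (m' + y))) h1 3
        have := hL y; nlinarith
      have hA1 : A < 1 := by linarith
      -- (E115c): ε m ≥ Sy (So e) m − Var(g)/(1−A)
      have h1 := sol_ge_first_sub_var hRo hRy hKy0 hSo hSy hENDo hrown hA1 het hεt hεrec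
      -- (E115i): Sy v m ≥ Sy 1_N m · v m − Σ |Δv| A^{(J−m)/y}
      set v := So e with hv
      have h2 := sol_ge_deep_floor_sub_geom_var hRy hSy hKy0 hrown hA1.le hy hsuppy hENDy (hSo e het).1 (n := m)
      -- floors
      have hU : 1 - A ≤ Sy (fun m => if m ≤ N then (1 : ℝ) else 0) m :=
        (young_indicator_sol_bounds hmono hL hb hlo hdom hh hf hy hyK hKL hRy hSy le_rfl m).2.2 hmN
      have hU1 : Sy (fun m => if m ≤ N then (1 : ℝ) else 0) m ≤ 1 := (hENDy N m le_rfl).2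
      have hV : 1 - Bo ≤ v m := (young_indicator_sol_bounds hmono hL hb hlo hdom hh hf ho1 hoK hKL hRo hSo le_rfl m).2.2 hmN
      have hv01 : ∀ m', 0 ≤ v m' ∧ v m' ≤ 1 := fun m' => hENDo N m' le_rfl
      -- the weighted variation of v: rows J < N vary by ≤ (5/2)c, the last drop is ≤ 1 with weight ≤ A^12 ≤ 1/64
      have hstep : ∀ J, m ≤ J → J < N → |v J - v (J + 1)| ≤ 5 / 2 * (L o * h (m + o) ^ 3 / 2) := by
        intro J hmJ hJN
        have hst := flow_lone_step_abs_le hmono hL hb hlo hh hf hoK (by omega) hKL hRo (e := e) (hSo e het).2 hv01 hmJ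
        have he0 : e J - e (J + 1) = 0 := by simp only [he_def, if_pos (show J ≤ N by omega), if_pos (show J + 1 ≤ N by omega), sub_self]
        rw [he0, abs_zero, zero_add] at hst
        exact hst
      have hGV : ∑ J ∈ Ico m (N + 1), |v J - v (J + 1)| * A ^ ((J - m) / y)
          ≤ 5 / 2 * (L o * h (m + o) ^ 3 / 2) * ((y : ℝ) / (1 - A)) + 1 / 64 := by
        rw [sum_Ico_succ_top (by omega)]
        have hlast : |v N - v (N + 1)| * A ^ ((N - m) / y) ≤ 1 / 64 := by
          have hvN : |v N - v (N + 1)| ≤ 1 := by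
            have hv0 : v (N + 1) = 0 := (hSo e het).1 (N + 1) (by omega)
            rw [hv0, sub_zero, abs_of_nonneg (hv01 N).1]; exact (hv01 N).2
          have h12 : 12 ≤ (N - m) / y := (Nat.le_div_iff_mul_le (by omega)).mpr (by omega)
          have hpow : A ^ ((N - m) / y) ≤ A ^ 12 := pow_le_pow_of_le_one hA0 hA1.le h12
          have hA12 : A ^ 12 ≤ (Real.sqrt 2 / 2) ^ 12 := pow_le_pow_left₀ hA0 (hcapy m) 12
          rw [hs12] at hA12
          calc |v N - v (N + 1)| * A ^ ((N - m) / y) ≤ 1 * A ^ 12 := mul_le_mul hvN hpow (pow_nonneg hA0 _) zero_le_one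
            _ ≤ 1 / 64 := by linarith
        have hbulk : ∑ J ∈ Ico m N, |v J - v (J + 1)| * A ^ ((J - m) / y) ≤ 5 / 2 * (L o * h (m + o) ^ 3 / 2) * ((y : ℝ) / (1 - A)) := by
          calc ∑ J ∈ Ico m N, |v J - v (J + 1)| * A ^ ((J - m) / y) ≤ ∑ J ∈ Ico m N, 5 / 2 * (L o * h (m + o) ^ 3 / 2) * A ^ ((J - m) / y) :=
                sum_le_sum fun J hJ => mul_le_mul_of_nonneg_right (hstep J (mem_Ico.mp hJ).1 (mem_Ico.mp hJ).2) (pow_nonneg hA0 _)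
            _ = 5 / 2 * (L o * h (m + o) ^ 3 / 2) * ∑ J ∈ Ico m N, A ^ ((J - m) / y) := by rw [mul_sum]
            _ ≤ 5 / 2 * (L o * h (m + o) ^ 3 / 2) * ((y : ℝ) / (1 - A)) :=
                mul_le_mul_of_nonneg_left (geom_block_sum_le hA0 hA1 hy m N) (by have := hc0 m; positivity)
        linarith
      -- the remainder: the young reads cut at the pin
      set r' : ℕ → ℝ := fun c => if m < c then Ry ε c else 0 with hr'
      have hr'0 : ∀ c, 0 ≤ r' c := fun c => by
        simp only [hr']; split_ifs with hc
        · rw [hRy]; exact sum_nonneg fun l _ => mul_nonneg (hKy0 c l) (hbelow (c + 1 + l) (by omega)).1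
        · exact le_rfl
      have hr't : ∀ c, N < c → r' c = 0 := fun c hc => by
        simp only [hr']; split_ifs
        · rw [hRy]; exact sum_eq_zero fun l _ => by rw [hεt (c + 1 + l) (by omega), mul_zero]
        · rfl
      have hROeq : ∀ m', m ≤ m' → Ro (Ry ε) m' = Ro r' m' := fun m' hm' => by
        rw [hRo, hRo]; exact sum_congr rfl fun l _ => by simp only [hr', if_pos (show m < m' + 1 + l by omega)]
      have hVar : ∑ J' ∈ Ico m (N + 1), |Ro (Ry ε) J' - Ro (Ry ε) (J' + 1)| ≤ 4 * (L o * h (m + o) ^ 3 / 2) * Λ := by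
        have hv2 := var_read_le hRo hKt hw0 hwmono hr'0 hr't m
        rw [hwsum m] at hv2
        have heq : ∑ J' ∈ Ico m (N + 1), |Ro (Ry ε) J' - Ro (Ry ε) (J' + 1)| = ∑ J' ∈ Ico m (N + 1), |Ro r' J' - Ro r' (J' + 1)| :=
          sum_congr rfl fun J' hJ' => by have := (mem_Ico.mp hJ').1; rw [hROeq J' this, hROeq (J' + 1) (by omega)]
        rw [heq]
        refine hv2.trans (mul_le_mul_of_nonneg_left ?_ (by have := hc0 m; positivity))
        -- Σ r' ≤ young total mass ≤ y L_y h(m+y)/b ≤ Λ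
        have hrc : ∀ c ∈ Ico (m + 1) (N + 1), r' c ≤ (y : ℝ) * (L y * h (c + y) ^ 3 / 2) := by
          intro c hc
          have hmc : m < c := by have := (mem_Ico.mp hc).1; omega
          simp only [hr', if_pos hmc]
          rw [hRy]
          calc ∑ l ∈ range N, KL y c l * ε (c + 1 + l) ≤ ∑ l ∈ range N, KL y c l :=
                sum_le_sum fun l _ => by have := mul_le_mul_of_nonneg_left (hbelow (c + 1 + l) (by omega)).2 (hKy0 c l); linarith
            _ ≤ (y : ℝ) * (L y * h (c + y) ^ 3 / 2) := hrowy c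
        refine ((sum_le_sum hrc).trans (young_total_mass_le hL hb hlo hh hf y m (N + 1))).trans ?_
        have h1 : h (m + y) ≤ h y := hanti (by omega)
        have hyLb : 0 ≤ (y : ℝ) * L y / b := by have := hL y; positivity
        have h2 : (y : ℝ) * L y / b * h (m + y) ≤ (y : ℝ) * L y / b * h y := mul_le_mul_of_nonneg_left h1 hyLb
        have e1 : (y : ℝ) * L y * h (m + y) / b = (y : ℝ) * L y / b * h (m + y) := by ring
        have e2 : Λ = (y : ℝ) * L y / b * h y := by simp only [hΛ]; ring
        rw [e1, e2]; exact h2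
      -- assemble through the pure arithmetic of §1
      exact geom_zone_arith hratio' ho0 hy1 hΛ0 hAs hBos hU hV hco hGV hVar h1 h2

end Summit.QuantumFields.BalabanUV.Beta.EriceRemainderEnclosureHistoryAutonomyComparisonAgeCompositionKeyFreeTwoAges

end
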